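import Mathlib
import HarnessLib
import Literature.Computability.AlgebraicComplexity.AlmanLi2026SpectrumMatMul
import Summits.MatrixMultiplication.MatrixMultiplication.Theorems.FarEdgeDescentSymmetricCover
import Summits.MatrixMultiplication.MatrixMultiplication.Theorems.OutsiderSandwichExchangeRate
import Summits.MatrixMultiplication.MatrixMultiplication.Theorems.OutsiderSandwichExchangeExponent
import Summits.MatrixMultiplication.MatrixMultiplication.Theorems.OutsiderSandwichExchangeSpectral

/-!
# Outsider sandwich — the LEVEL-TWO RUNG of the exchange ladder, effective (decomp-mm lens-4, g20; part 4)

Docks lens-2's symmetric cover (`FarEdgeDescentSymmetricCover.matMulSq_le_unitTwo_coupling₁Sq`: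
`⟨2⟩ ⊠ C₁^{⊠2} ⊵ ⟨2,2,2⟩^{⊠2}`, explicit matrices over every commutative ring) into the exchange ladder of
`OutsiderSandwichExchangeRate/Exponent/Spectral`.  All hypothesis-free and EFFECTIVE (no `ω`, no laser method):
* **`r(2) = 2`** (`exchangeNumber_two`; with `r(1) = 2`: the first two exchange numbers are known exactly),
  `r(N) ≤ 2^{⌈N/2⌉}` for all `N` (`exchangeNumber_le_two_pow_half`), `ExponentAchieved (1/2)`, `θ⋆ ≤ 1/2`;
* the SPECTRAL SHADOW of the level-two certificate: **every universal spectral point satisfies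
  `F⟨2,2,2⟩² ≤ 2 · F(C₁)²`** (`sq_map_matMul_le`), i.e. in Alman–Li coordinates
  **`θ₁ + θ₂ + θ₃ ≤ 1/2 + log₂ F(C₁)`** on the whole asymptotic spectrum (`sum_specMMPoint_le_half_add_logb`) —
  an explicit linear inequality between the spectrum of `⟨2,2,2⟩` and the value at the CW block `C₁`, to be
  compared with the target `θ₁ + θ₂ + θ₃ ≤ log₂ F(C₁)` (= the leaf `BlockOneIsMM`,
  `blockOneIsMM_iff_forall_sum_specMMPoint_le`) and with the ineffective `θ⋆ ≤ ω − 2 ≤ 0.37295`.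

[Strassen1988, Thm. 3.8]; [AlmanLi2026, Prop. 4.2]; [ChristandlVranaZuiddam2023, §1.2].
-/

noncomputable section

open Literature.Computability.AlgebraicComplexity
open Summit.MatrixMultiplication.MatrixMultiplication.Theorems.OutsiderSandwichCoupling (coupling₁)
open Summit.MatrixMultiplication.MatrixMultiplication.Theorems.OutsiderSandwichExchangeRate
open Summit.MatrixMultiplication.MatrixMultiplication.Theorems.OutsiderSandwichExchangeExponent
open Summit.MatrixMultiplication.MatrixMultiplication.Theorems.OutsiderSandwichExchangeSpectral

namespace Summit.MatrixMultiplication.MatrixMultiplication.Theorems.OutsiderSandwichExchangeLevelTwo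

/-! ## 1. The level-two certificate and the exchange numbers -/

/-- **`Helped 2 2`**: two helping copies suffice at level two (lens-2's symmetric cover
`K^{4×4} = 𝐒 + P·𝐒`). [cite: Strassen1988, Thm. 3.8] -/
theorem helped_two_two : Helped 2 2 :=
  FarEdgeDescentSymmetricCover.matMulSq_le_unitTwo_coupling₁Sq

/-- **`r(2) = 2`.** [cite: Strassen1988, Thm. 3.8] -/
theorem exchangeNumber_two : exchangeNumber 2 = 2 :=
  le_antisymm (exchangeNumber_le helped_two_two) (two_le_exchangeNumber (by norm_num))

/-- `Helped (2k) (2^k)`. [cite: Strassen1988, Thm. 3.8] -/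
theorem helped_two_mul (k : ℕ) : Helped (2 * k) (2 ^ k) := by
  have h := helped_pow helped_two_two k
  rwa [mul_comm] at h

/-- **`r(N) ≤ 2^{⌈N/2⌉}`** for every `N` (pad an odd level with the level-one certificate).
[cite: Strassen1988, Thm. 3.8] -/
theorem exchangeNumber_le_two_pow_half (N : ℕ) : exchangeNumber N ≤ 2 ^ ((N + 1) / 2) := by
  obtain ⟨k, rfl | rfl⟩ := Nat.even_or_odd' N
  · have e : (2 * k + 1) / 2 = k := by omega
    rw [e]
    exact exchangeNumber_le (helped_two_mul k)
  · have e : (2 * k + 1 + 1) / 2 = k + 1 := by omega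
    rw [e, pow_succ]
    calc exchangeNumber (2 * k + 1) ≤ exchangeNumber (2 * k) * exchangeNumber 1 := exchangeNumber_add_le _ _
      _ ≤ 2 ^ k * 2 := by
          rw [exchangeNumber_one]
          exact Nat.mul_le_mul_right 2 (exchangeNumber_le (helped_two_mul k))

/-- **`ExponentAchieved (1/2)`** (effective). [cite: Strassen1988, Thm. 3.8] -/
theorem exponentAchieved_half : ExponentAchieved (1 / 2) :=
  exponentAchieved_half_of_levelTwo helped_two_two

/-- `θ⋆ ≤ 1/2` (effective; the ineffective `θ⋆ ≤ ω − 2 ≤ 0.37295` is `exchangeExponent_le_leGall`).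
[cite: Strassen1988, Thm. 3.8] -/
theorem exchangeExponent_le_half : exchangeExponent ≤ 1 / 2 :=
  exchangeExponent_le exponentAchieved_half

/-- The first two exchange numbers: `r(1) = r(2) = 2`; so `log₂ r(N)/N` is `1, 1/2` at `N = 1, 2`.
[cite: Strassen1988, Thm. 3.8] -/
theorem exchangeNumber_one_two : exchangeNumber 1 = 2 ∧ exchangeNumber 2 = 2 :=
  ⟨exchangeNumber_one, exchangeNumber_two⟩

/-! ## 2. The spectral shadow of the level-two certificate -/

/-- `SpectralRatioLe (1/2)`: **`F⟨2,2,2⟩ ≤ √2 · F(C₁)`** at every universal point. [cite: Strassen1988, Thm. 3.8] -/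
theorem spectralRatioLe_half : SpectralRatioLe (1 / 2) :=
  spectralRatioLe_of_exponentAchieved exponentAchieved_half

/-- **`F⟨2,2,2⟩² ≤ 2 · F(C₁)²`** at every universal spectral point. [cite: Strassen1988, Thm. 3.8] -/
theorem sq_map_matMul_le {F : SpectralMap ℂ} (hF : IsUniversalSpectralPoint ℂ F) :
    F (matMulTensor ℂ 2 2 2) ^ 2 ≤ 2 * F coupling₁ ^ 2 := by
  have h := pow_le_of_helped helped_two_two hF
  exact_mod_cast h

/-- `F⟨2,2,2⟩ ≤ 2 · F(C₁)` at every universal point (the level-one shadow, `r(1) = 2`).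
[cite: Strassen1988, Thm. 3.8] -/
theorem map_matMul_le_two_mul {F : SpectralMap ℂ} (hF : IsUniversalSpectralPoint ℂ F) :
    F (matMulTensor ℂ 2 2 2) ≤ 2 * F coupling₁ := by
  have h := pow_le_of_helped helped_one_two hF
  simpa using h

/-- `logRatio F ≤ 1/2` at every universal point. [cite: Strassen1988, Thm. 3.8] -/
theorem logRatio_le_half {F : SpectralMap ℂ} (hF : IsUniversalSpectralPoint ℂ F) : logRatio F ≤ 1 / 2 :=
  (logRatio_le_exchangeExponent hF).trans exchangeExponent_le_half

/-- **In Alman–Li coordinates: `θ₁ + θ₂ + θ₃ ≤ 1/2 + log₂ F(C₁)`** at every universal spectral point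
(effective; the leaf `BlockOneIsMM` is the same inequality without the `1/2`). [cite: AlmanLi2026, Prop. 4.2] -/
theorem sum_specMMPoint_le_half_add_logb {F : SpectralMap ℂ} (hF : IsUniversalSpectralPoint ℂ F) :
    (∑ i, specMMPoint ℂ F i) ≤ 1 / 2 + Real.logb 2 (F coupling₁) := by
  have h := logRatio_le_half hF
  rw [logRatio_eq_sum_specMMPoint_sub hF] at h
  linarith

/-- **Where a counterexample to the leaf can live**: a universal point violating `BlockOneIsMM` has
`log₂ F(C₁) < θ₁+θ₂+θ₃ ≤ min (ω, 1/2 + log₂ F(C₁))` — a window of width `≤ 1/2` above `log₂ F(C₁) ≥ 2`.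
[cite: AlmanLi2026, Prop. 4.2] -/
theorem counterexample_window {F : SpectralMap ℂ} (hF : IsUniversalSpectralPoint ℂ F)
    (hviol : F coupling₁ < F (matMulTensor ℂ 2 2 2)) :
    Real.logb 2 (F coupling₁) < ∑ i, specMMPoint ℂ F i ∧
      (∑ i, specMMPoint ℂ F i) ≤ 1 / 2 + Real.logb 2 (F coupling₁) ∧
      (∑ i, specMMPoint ℂ F i) ≤ omega ℂ := by
  refine ⟨?_, sum_specMMPoint_le_half_add_logb hF, AlmanLi2026.prop42_sum_le_omega hF⟩
  have hC : (0 : ℝ) < F coupling₁ := lt_of_lt_of_le (by norm_num) (four_le_map_coupling₁ hF)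
  have hM : (0 : ℝ) < F (matMulTensor ℂ 2 2 2) := hC.trans hviol
  have h : (0 : ℝ) < logRatio F := by
    rw [logRatio]
    exact Real.logb_pos (by norm_num) ((one_lt_div hC).2 hviol)
  rw [logRatio_eq_sum_specMMPoint_sub hF] at h
  linarith

end Summit.MatrixMultiplication.MatrixMultiplication.Theorems.OutsiderSandwichExchangeLevelTwo

end
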